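import Literature.Probability.FitznerVanDerHofstad2017.Stage1PolygonDplus

/-!
# HOME DRAFT (pub-lace10 typer g3, NOT filed — inventory §2 decision A8, lead g20 DEFAULT, RULING D54 ADDENDUM (11); Level-C lead decides on day 1)
# `Rem.openSquareEDunder` — the ST10′ open square VERBATIM: D12 additive + D26 `10 ↦ ComputedSteps` + D27 two-tail `C(L+2,2)`, with the ONE-TAIL
# multiplicity in the PRINTED-KEPT form `C(L+4,3) = (CS+2−m)(CS+3−m)(CS+4−m)/6` (engine-B `d27under` WITHOUT `osqn`; lace7 TOKENS-ST10 l.10)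

HONEST FRAMING.  Pure `PX` text + one termwise comparison; no numeral of the notebooks, no table, no percolation claim.  The tree's
`Stage1PolygonDplus.Rem.openSquareEDplus` (:258) carries the COUNTED one-tail multiplicity `C(L+3,3)` (`RepulsivePolygonMultiplicities.card_sqTriplesO_eq_choose`);
the d = 10 record stack ST10′ (pub-lace10 `engine/ivq/stage1/patched_cells_ALL_Rev2.txt` cell [49] l.1943–1944) carries `(1/6)(CS+2−m)(CS+3−m)(CS+4−m)` =
`C(L+4,3)`, the printed `(1/6)∏_{s=1}^{3}(M−m_{1,4}+s)` of [NoBLE17-I] (5.42) at `M = CS+1` KEPT (licence: `RepulsivePolygonMultiplicities.sum3_diagS_le_extraction_printedShape`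
:422).  This file types the ST10′ text so that the Level-C recipe can tie ENTRY BY ENTRY to the record's literals (typer g3 `typed/REDERIVED-ROWS.md` §1.4 / L-1);
`eval_openSquareEDplus_le_EDunder` records that the tree's counted cell is termwise below it.
[cite: FitznerVanDerHofstad2016NoBLE, §5.3.2 (5.42) PTRF p. 1098] [cite: FitznerVanDerHofstad2017, notebook Percolation.nb cell 12 (transcript l.419–429)]
-/

namespace Literature.Probability.FitznerVanDerHofstad2017
namespace Stage1Cells

open NoGoFrame PX

section plain

variable (P : Params)

/-- ST10′ open-square extraction branch (plain table reads): additive, `ComputedSteps` for the literal `10`, one-tail `C(CS+4−m,3)` = `(CS+2−m)(CS+3−m)(CS+4−m)/6`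
(printed-kept), two-tail `C(CS+2−m,2)`, three-tail `CS+1−m`, four-tail `1`. [cite: FitznerVanDerHofstad2016NoBLE, §5.3.2 (5.42) PTRF p. 1098] -/
def openSquareEDunder (m k : ℕ) : T :=
  max (sumR m P.CS fun j => C (j + 1 - m) * C (j + 2 - m) * C (j + 3 - m) * z ^ j * tab (.baw j .v2) /ₙ 6)
      (sumR m P.CS fun j => C (j + 1 - m) * C (j + 2 - m) * C (j + 3 - m) * z ^ j * tab (.baw j .v1) /ₙ 6)
    + C (P.CS + 2 - m) * C (P.CS + 3 - m) * C (P.CS + 4 - m) * w P ^ (P.CS + 1 - k) * Vg * tab (.K 1 (P.CS + 1) .v1) /ₙ 6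
    + C (P.CS + 2 - m) * C (P.CS + 1 - m) * w P ^ (P.CS + 1 - k) * Vg ^ 2 * tab (.K 2 (P.CS + 1) .v1) /ₙ 2
    + C (P.CS + 1 - m) * w P ^ (P.CS + 1 - k) * Vg ^ 3 * tab (.K 3 (P.CS + 1) .v1)
    + w P ^ (P.CS + 1 - k) * Vg ^ 4 * tab (.K 4 (P.CS + 1) .v1)

/-- ST10′ open square `Min[K-branch, EDunder]`. [cite: FitznerVanDerHofstad2016NoBLE, §5.3.2 (5.42) PTRF p. 1098] -/
def openSquareDunder (m k : ℕ) : T := min (openSquareK P m k) (openSquareEDunder P m k)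

end plain

namespace Rem

section slotted

variable (P : Params) (ρ : Fin 10 → T)

/-- (slotted, remainder reads `K[n,CS+1,{1}] ↦ ρ (n+5)`) ST10′ open-square extraction branch with the printed-kept one-tail `C(CS+4−m,3)` — the text of
[ST10′] cell [49] l.1943–1944 term by term. [cite: FitznerVanDerHofstad2016NoBLE, §5.3.2 (5.42) PTRF p. 1098] -/
def openSquareEDunder (m k : ℕ) : T :=
  max (sumR m P.CS fun j => C (j + 1 - m) * C (j + 2 - m) * C (j + 3 - m) * z ^ j * tab (.baw j .v2) /ₙ 6)
      (sumR m P.CS fun j => C (j + 1 - m) * C (j + 2 - m) * C (j + 3 - m) * z ^ j * tab (.baw j .v1) /ₙ 6)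
    + C (P.CS + 2 - m) * C (P.CS + 3 - m) * C (P.CS + 4 - m) * w P ^ (P.CS + 1 - k) * Vg * ρ 6 /ₙ 6
    + C (P.CS + 2 - m) * C (P.CS + 1 - m) * w P ^ (P.CS + 1 - k) * Vg ^ 2 * ρ 7 /ₙ 2
    + C (P.CS + 1 - m) * w P ^ (P.CS + 1 - k) * Vg ^ 3 * ρ 8
    + w P ^ (P.CS + 1 - k) * Vg ^ 4 * ρ 9

/-- (slotted) ST10′ open square `Min[K-branch, EDunder]`. [cite: FitznerVanDerHofstad2016NoBLE, §5.3.2 (5.42) PTRF p. 1098] -/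
def openSquareDunder (m k : ℕ) : T := min (openSquareK P m k) (Rem.openSquareEDunder P ρ m k)

end slotted

/-! ## The tree's counted cell is termwise below the ST10′ cell (real semantics, any non-negative valuation incl. the slots) -/

section Direction

variable (P : Params) (ρ : Fin 10 → T) {va : Atom → ℝ} {vt : TKey → ℝ}

/-- `C(L+3,3) ≤ C(L+4,3)`: `Rem.openSquareEDplus ≤ Rem.openSquareEDunder` pointwise — the printed one-tail multiplicity
`(1/6)∏_{s=1}^{3}(M−m_{1,4}+s)` of (5.42) (kept by ST10′) dominates the tree's COUNTED `C(L+3,3)` termwise, under any non-negative valuation.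
[cite: FitznerVanDerHofstad2016NoBLE, §5.3.2 (5.42) PTRF p. 1098] -/
theorem eval_openSquareEDplus_le_EDunder (ha : ∀ i, 0 ≤ va i) (ht : ∀ k, 0 ≤ vt k) (m k : ℕ) :
    eval va vt (Rem.openSquareEDplus P ρ m k) ≤ eval va vt (Rem.openSquareEDunder P ρ m k) := by
  simp only [Rem.openSquareEDplus, Rem.openSquareEDunder, eval_add, eval_mul, eval_C, eval_divN]
  have h0 : ∀ e : T, 0 ≤ eval va vt e := eval_nonneg ha ht
  have hw := h0 (w P ^ (P.CS + 1 - k)); have hV := h0 (Vg : T); have h6 := h0 (ρ 6)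
  have hn : ((P.CS + 1 - m : ℕ) : ℝ) * ((P.CS + 2 - m : ℕ) : ℝ) * ((P.CS + 3 - m : ℕ) : ℝ)
      ≤ ((P.CS + 2 - m : ℕ) : ℝ) * ((P.CS + 3 - m : ℕ) : ℝ) * ((P.CS + 4 - m : ℕ) : ℝ) := by
    have h1 : ((P.CS + 1 - m : ℕ) : ℝ) ≤ ((P.CS + 4 - m : ℕ) : ℝ) := by exact_mod_cast (by omega : P.CS + 1 - m ≤ P.CS + 4 - m)
    nlinarith [Nat.cast_nonneg (α := ℝ) (P.CS + 2 - m), Nat.cast_nonneg (α := ℝ) (P.CS + 3 - m),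
      mul_nonneg (Nat.cast_nonneg (α := ℝ) (P.CS + 2 - m)) (Nat.cast_nonneg (α := ℝ) (P.CS + 3 - m))]
  have key : ((P.CS + 1 - m : ℕ) : ℝ) * ((P.CS + 2 - m : ℕ) : ℝ) * ((P.CS + 3 - m : ℕ) : ℝ) * eval va vt (w P ^ (P.CS + 1 - k)) * eval va vt (Vg : T) * eval va vt (ρ 6) / 6
      ≤ ((P.CS + 2 - m : ℕ) : ℝ) * ((P.CS + 3 - m : ℕ) : ℝ) * ((P.CS + 4 - m : ℕ) : ℝ) * eval va vt (w P ^ (P.CS + 1 - k)) * eval va vt (Vg : T) * eval va vt (ρ 6) / 6 := by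
    gcongr
  linarith

end Direction

end Rem
end Stage1Cells
end Literature.Probability.FitznerVanDerHofstad2017
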